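import Literature.NumberTheory.GaloisCohomology.MuPadicLine
import Literature.NumberTheory.GaloisRepresentations.ContinuousCohomologyCoboundaryLift
import HarnessLib

/-!
# The `ℤ_p`-action on `ℤ_p(1)(K̄)` as endomorphisms of the topological representation: twisted `2`-cocycles,
# `inv_∞(a • x) = a · inv_∞(x)`, and scaling of coboundary lifts

Topic `NumberTheory/GaloisCohomology`; namespace `Literature.NumberTheory.GaloisCohomology`. Sequel of `CupProductMuPadicCharacter`
(`twistHom K p : ℤ_p(1) →+ ℤ_p →+ ℤ_p(1)`, `(ζ, a) ↦ ζ^a`, equivariant `twistHom_smul`, continuous), `MuPadicLine` (the `ℤ_p`-line structure)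
and `LocalInvariantMapPadic` (`invPadic`, level formula `toZModPow_invPadic`). The Tate module `tateModuleMuPadic K p` is a `ℤ`-linear
`TopRep` (no `Module ℤ_[p]` instance is registered, D-0014), so the `ℤ_p`-module structure of `H²(K, ℤ_p(1))` is supplied through
MORPHISMS:

* `twistMor K p a : ℤ_p(1) ⟶ ℤ_p(1)`, `ζ ↦ ζ^a` as an endomorphism of the topological representation (definition with body), and the
  twisted `2`-cocycle `twistCocycle₂ a c = (σ, τ) ↦ c(σ, τ)^a` (abbrev for `contTwoCocycles.pullback id (resIdHom (twistMor a))`);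
  `cohomologyMap_twistMor_twoCocycleClass` (`H²(twistMor a)[c] = [c^a]`), `projCocycle₂_twistCocycle₂` (levelwise `(a mod pᵏ) • c_k`);
* ★★ `invPadic_twoCocycleClass_twistCocycle₂` / `invPadic_cohomologyMap_twistMor` — **`inv_∞([c]^a) = a · inv_∞([c])`**: the `p`-adic
  invariant map is `ℤ_p`-LINEAR for the twist action (levelwise `inv_{pᵏ}` is additive and `[c^a]_k = (a mod pᵏ) • [c]_k`);
* ★ `IsCoboundaryLift.twist_muPadic` (namespace `GaloisRepresentations`) — **scaling a coboundary lift**: if `f` presents `c` through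
  `ι : ℤ_p(1) → B` and `s : B → B` is additive, commutes with the ambient action and satisfies `s ∘ ι = ι ∘ (·)^a`, then `s ∘ f` presents
  `c^a` (e.g. `B = B_dR⁺`, `s = (a · t/t) ·` multiplication by `a`, `ι(ζ^a) = a ι(ζ)`: `PAdicHodge.BdRPlusTop.periodLine_twistHom`).

Use: comparing presentations of `η ∪ κ_P` and of `κ_u ∪ ψ` in `H²(F, ℤ_p(1)) ≅ ℤ_p` up to `p`-adic INTEGER multiples (line
`kato_lever` of crux K★ `stmt-BirchSwinnertonDyer-22226`, Kato LNM 1553 II §1.4). BSD / K★ / [REC] are NOT proved by any of this.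

## References
* K. Kato, LNM 1553 (1993), Ch. II 1.4.2, Thm. 1.4.1 (1). [Kato1993LNM1553]
* J. Neukirch, A. Schmidt, K. Wingberg (2008), II §7 (2.7.5), VII (7.3.6). [NeukirchSchmidtWingberg2008]
* J.-P. Serre (1968), Ch. I §1.2. [Serre1968]
-/

noncomputable section

open CategoryTheory Function Field

namespace Literature.NumberTheory.GaloisCohomology

open _root_.TopRep _root_.ContRepresentation _root_.ContinuousCohomology
open Literature.NumberTheory.GaloisRepresentations
open Literature.NumberTheory.GaloisRepresentations.DiscreteGaloisModule
open Literature.AnabelianGeometry.AbsoluteAnabelian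

section Twist

variable (K : Type) [Field K] (p : ℕ) [hp : Fact p.Prime]

/-- **`ζ ↦ ζ^a` as an endomorphism of the topological representation `ℤ_p(1)(K̄)`** (`a ∈ ℤ_p`; additive, continuous, equivariant:
`twistHom_smul`). [cite: Kato1993LNM1553, Ch. II 1.4.2] [cite: NeukirchSchmidtWingberg2008, VII (7.3.6)] -/
def twistMor (a : ℤ_[p]) : (tateModuleMuPadic K p).toTopRep ⟶ (tateModuleMuPadic K p).toTopRep :=
  TopRep.ofHom
    { toFun := fun ζ => twistHom K p ζ a
      map_add' := fun ζ ζ' => by rw [map_add, AddMonoidHom.add_apply]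
      map_smul' := fun c ζ => by
        change (twistHom K p).flip a (c • ζ) = c • (twistHom K p).flip a ζ
        rw [map_zsmul]
      cont := (continuous_twistHom K p).comp (continuous_id.prodMk continuous_const)
      isIntertwining' := fun σ => ContinuousLinearMap.ext fun ζ => by
        change twistHom K p (tateModuleMuPadic K p σ ζ) a = tateModuleMuPadic K p σ (twistHom K p ζ a)
        exact twistHom_smul K p σ ζ a }

/-- Unfolding `twistMor`. [cite: Kato1993LNM1553, Ch. II 1.4.2] -/
@[simp] theorem twistMor_hom_apply (a : ℤ_[p]) (ζ : (muPadicSystem K p).limit) : (twistMor K p a).hom ζ = twistHom K p ζ a := rfl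

variable {K p}

/-- **The twisted `2`-cocycle `c^a : (σ, τ) ↦ c(σ, τ)^a`** (the push-forward of `c` along `twistMor a`).
[cite: Kato1993LNM1553, Ch. II 1.4.2] -/
abbrev twistCocycle₂ (a : ℤ_[p]) (c : contTwoCocycles (tateModuleMuPadic K p).toTopRep) :
    contTwoCocycles (tateModuleMuPadic K p).toTopRep :=
  contTwoCocycles.pullback (ContinuousMonoidHom.id _) (resIdHom (twistMor K p a)) c

/-- Values of the twisted cocycle. [cite: Kato1993LNM1553, Ch. II 1.4.2] -/
@[simp] theorem twistCocycle₂_apply (a : ℤ_[p]) (c : contTwoCocycles (tateModuleMuPadic K p).toTopRep)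
    (q : absoluteGaloisGroup K × absoluteGaloisGroup K) : (twistCocycle₂ a c).1 q = twistHom K p (c.1 q) a := by
  obtain ⟨σ, τ⟩ := q
  rfl

/-- **Levelwise, `c^a` is `(a mod pᵏ) • c`**: `pr_k (c^a) = (a mod pᵏ) • pr_k c` as `2`-cocycles of `μ_{pᵏ}`.
[cite: NeukirchSchmidtWingberg2008, II §7 (2.7.5)] -/
theorem projCocycle₂_twistCocycle₂ (a : ℤ_[p]) (c : contTwoCocycles (tateModuleMuPadic K p).toTopRep) (k : ℕ) :
    (muPadicSystem K p).projCocycle₂ k (twistCocycle₂ a c) =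
      (PadicInt.toZModPow k a).val • (muPadicSystem K p).projCocycle₂ k c := by
  refine Subtype.ext (ContinuousMap.ext fun q => ?_)
  rw [DiscreteInvSystem.projCocycle₂_apply, twistCocycle₂_apply, coe_twistHom, twistCoord_eq_zsmul, natCast_zsmul,
    AddSubmonoidClass.coe_nsmul, ContinuousMap.nsmul_apply, DiscreteInvSystem.projCocycle₂_apply]

variable [LocallyCompactSpace (absoluteGaloisGroup K)]

/-- `H²(twistMor a)[c] = [c^a]`. [cite: Kato1993LNM1553, Ch. II 1.4.2] -/
theorem cohomologyMap_twistMor_twoCocycleClass (a : ℤ_[p]) (c : contTwoCocycles (tateModuleMuPadic K p).toTopRep) :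
    cohomologyMap (twistMor K p a) 2 (twoCocycleClass _ c) = twoCocycleClass _ (twistCocycle₂ a c) :=
  cohomologyMap_twoCocycleClass _ c

end Twist

/-! ### `inv_∞` is `ℤ_p`-linear for the twist action -/

section Inv

variable {K : Type} [Field K] [ValuativeRel K] [TopologicalSpace K] [IsNonarchimedeanLocalField K] [CharZero K]
  {p : ℕ} [hp : Fact p.Prime] [LocallyCompactSpace (absoluteGaloisGroup K)]

/-- ★★ **`inv_∞([c^a]) = a · inv_∞([c])`** (a `p`-adic integer is determined by its residues; levelwise `[c^a]_k = (a mod pᵏ) • [c]_k`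
and `inv_{pᵏ}` is additive). [cite: Kato1993LNM1553, Ch. II Thm. 1.4.1 (1) and 1.4.2] -/
theorem invPadic_twoCocycleClass_twistCocycle₂ (a : ℤ_[p]) (c : contTwoCocycles (tateModuleMuPadic K p).toTopRep) :
    invPadic K p (twoCocycleClass _ (twistCocycle₂ a c)) = a * invPadic K p (twoCocycleClass _ c) := by
  refine PadicInt.ext_of_toZModPow.mp fun k => ?_
  haveI : NeZero (p ^ k) := ⟨pow_ne_zero _ hp.out.ne_zero⟩
  rw [toZModPow_invPadic, map_mul, toZModPow_invPadic, DiscreteInvSystem.cohomologyMap_projHom_twoCocycleClass,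
    DiscreteInvSystem.cohomologyMap_projHom_twoCocycleClass, projCocycle₂_twistCocycle₂]
  have h1 : twoCocycleClass _ ((PadicInt.toZModPow k a).val • (muPadicSystem K p).projCocycle₂ k c) =
      (PadicInt.toZModPow k a).val • twoCocycleClass _ ((muPadicSystem K p).projCocycle₂ k c) :=
    map_nsmul (twoCocycleClassₗ _) _ _
  let ι : continuousCohomology 2 (mu K (p ^ k)).toTopRep →+ ZMod (p ^ k) := Prop121vii.invLevel K (p ^ k)
  change ι _ = _ * ι _
  rw [h1, map_nsmul ι, nsmul_eq_mul, ZMod.natCast_zmod_val]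

/-- ★★ **`inv_∞ ∘ H²(twistMor a) = a · inv_∞`**: the `p`-adic invariant map is `ℤ_p`-linear for the twist action on `H²(K, ℤ_p(1))`.
[cite: Kato1993LNM1553, Ch. II Thm. 1.4.1 (1) and 1.4.2] -/
theorem invPadic_cohomologyMap_twistMor (a : ℤ_[p]) (x : continuousCohomology 2 (tateModuleMuPadic K p).toTopRep) :
    invPadic K p (cohomologyMap (twistMor K p a) 2 x) = a * invPadic K p x := by
  obtain ⟨c, rfl⟩ := twoCocycleClass_surjective ((tateModuleMuPadic K p).toTopRep) x
  rw [cohomologyMap_twistMor_twoCocycleClass, invPadic_twoCocycleClass_twistCocycle₂]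

end Inv

end Literature.NumberTheory.GaloisCohomology

/-! ### Scaling coboundary lifts of `ℤ_p(1)`-valued cocycles -/

namespace Literature.NumberTheory.GaloisRepresentations.IsCoboundaryLift

open Literature.NumberTheory.GaloisCohomology

variable {K : Type} [Field K] {p : ℕ} [Fact p.Prime]
  {S : Type*} [CommSemiring S] {B : Type*} [AddCommGroup B] [Module S B] {π : Representation S (absoluteGaloisGroup K) B}
  {ι : (muPadicSystem K p).limit →+ B}

/-- ★ **Scaling a coboundary lift by `a ∈ ℤ_p`.** If `f` presents the `ℤ_p(1)`-valued `2`-cocycle `c` through `ι : ℤ_p(1) → B`, and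
`s : B → B` is additive, commutes with the ambient action and satisfies `s (ι ζ) = ι (ζ^a)`, then `s ∘ f` presents `c^a` through `ι`
(for `B = B_dR⁺`, `s` = multiplication by `a`: `ι(ζ^a) = a · ι(ζ)`). [cite: NeukirchSchmidtWingberg2008, I §3 (1.3.2)] [cite: Kato1993LNM1553, Ch. II 1.4.2] -/
theorem twist_muPadic {f : absoluteGaloisGroup K → B} {c : contTwoCocycles (tateModuleMuPadic K p).toTopRep}
    (hc : IsCoboundaryLift (ρ := tateModuleMuPadic K p) π ι f c) (a : ℤ_[p]) (s : B →+ B)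
    (hs : ∀ (σ : absoluteGaloisGroup K) (b : B), s (π σ b) = π σ (s b)) (hsι : ∀ ζ, s (ι ζ) = ι (twistHom K p ζ a)) :
    IsCoboundaryLift (ρ := tateModuleMuPadic K p) π ι (fun σ => s (f σ)) (twistCocycle₂ a c) := fun σ τ => by
  rw [twistCocycle₂_apply, ← hsι, hc σ τ, map_add, map_sub, hs]

end Literature.NumberTheory.GaloisRepresentations.IsCoboundaryLift

end
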